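import Summits.BirchSwinnertonDyer.Rank1Residual.X2.CongruenceTransferMultiplicativeDerived
import Summits.BirchSwinnertonDyer.Rank1Residual.X2.CongruenceTransferCoveredNonsplit
import Summits.BirchSwinnertonDyer.Rank1Residual.X2.CongruentPartnerAnomalous
import Summits.BirchSwinnertonDyer.Rank1Residual.X2.RankOneSplitResidueExact
import HarnessLib

/-!
# Class X2c = residual class O9 at a SPLIT prime: ROUTE G's missing quadrant — Mazur's main
# conjecture and `BSD(E₀,p)` at a SPLIT rank-one Eisenstein pair from a CONGRUENT relative with known
# main conjecture, modulo the typed residue and the Schneider certificate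
# (cell `b2b-bsdres`, lane CLASS-CLOSURE, seat `cc-typer-6` = O9 typer of record;
# `class-closure/O9/LEAD-DEAL-o9p.md` item T-O9P-2 (a)/(b))

HONEST FRAMING (run/shared/lean/b2b/bsd-rank1-residual/, verbatim in every file): the goal of the
cell is to DELETE the COMBINATION-SHAPED residual classes of the Birch–Swinnerton-Dyer formula for
ALL analytic-rank `≤ 1` elliptic curves over `ℚ` — "full BSD formula for every rank `≤ 1` curve in
class `C`" assembled STRICTLY from published theorems — so that the rank-`≤ 1` remainder becomes
exactly the CONSTRUCTION-SHAPED classes, which are TYPED (missing-input `Prop`s), NOT attempted.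
This is not "finishing BSD". Research route; NO CLAIM BEYOND STATED CLASSES; census / instrument
output is EVIDENCE, never a Literature fact; nothing here changes a label; X2c stays
CONSTRUCTION-SHAPED; `O9.ExceptionalLeadingTermAt` stays a `@[conjecture]` — nothing about it is
asserted here. THEOREMS ONLY: no definition, no new named fact; every class-level input is a
REGISTERED Literature fact BY NAME (Greenberg–Vatsal 2000 Thm. (1.4) machinery at `p ‖ N`: `hT`,
`hT'`, `hAm`, `hBm`, `hF`; Wuthrich Thm. 16 `hWu`; Stein–Wuthrich Thm. 6.1 `hJs`/`hJn` with the §4.2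
heights `hHs`/`hHn`; Gross–Zagier `hGZ`; GZK; modularity `hpar`), every per-pair input a typed
residue or a certificate binder (analytic `(μ, λ)` certificates of target and relative, the `δ`-shift
over the finite set `S₀` of bad places off `p`, `E₀[p] ≅ E₀'[p]` as `Γ_ℚ`-modules, the Schneider
certificate, and — at a split rank-one pair — the typed exceptional leading term).

## What

* §0 NEGATIVE BOOKKEEPING: `gvPar_iff_of_torsionIso` — the Greenberg–Vatsal parity type is an
  invariant of the `Γ_ℚ`-module `E[p]` (`GVPar` is "some rational line is ramified-even or
  unramified-odd"; lines, ramification and parity transport along a `Γ_ℚ`-equivariant isomorphism,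
  `gvPar_of_map_injOn`). So a route-G relative NEVER changes the parity sub-cell: a relative of GV
  parity helps only a target of GV parity, where Mazur's MC is Greenberg–Vatsal's anyway — the
  congruence route is useful exactly on the `¬GVPar` cells (O9 `CellCSplitNotGV` 7 728, N9 X2b).
* §1 T-O9P-2 (a): `O9.bsdp_of_closedRelative_rankOne_split_of_exceptionalLeadingTerm` — the SPLIT twin
  of `bsdp_of_coveredRelative_rankOne_of_not_split` (cc-typer-6 GEN 1, `CongruenceTransferRankOne`):
  at a SPLIT X2c pair `(E₀, p)`, Mazur's MC at the pair from a MULTIPLICATIVE relative `E₀'` with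
  `X2.MazurMainConjectureAt W' p` by eisenstein-p2's `mazurMainConjectureAt_of_closedRelative_mult_of_facts`
  (shift DERIVED, `+1` trivial zero on both sides — the relative is split too,
  `CongruentPartnerAnomalous.split_iff_split_of_torsionIso`), then `BSD(E₀,p)` by cc-typer-6's
  `bsdp_of_cellC_of_split_of_mazurMainConjectureAt_of_exceptionalLeadingTerm` granted the typed residue
  `O9.ExceptionalLeadingTermAt W p` and the Schneider certificate. Variants: (i) relative λ-MINIMAL
  (`(μ_an, λ_an)(E₀') = (0, r' + 1)`: its MC is a theorem, `mazurMainConjectureAt_of_lamMin`) —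
  `…_of_lamMinRelative_…`; (iii) GOOD-ORDINARY (necessarily anomalous) relative with the X1 main
  conjecture `MazurMainConjecture W' p` as a HYPOTHESIS (its discharge is class N1's problem) —
  `…_of_goodRelative_…` via `algebraicInvariantsEq_of_closedRelative_goodOrd_of_facts`.
  (ii) "relative of GV parity" is §0: it forces the TARGET to be of GV parity, where
  `mazurMainConjectureAt_of_gvPar_of_facts` applies without any relative.
* §2 T-O9P-2 (b): `O9.exceptionalLeadingTermAt_iff_bsdp_of_lamMinRelative_split` — COROLLARY
  "λ-minimal somewhere in the mod-`p` congruence class": a split X2c pair with a congruent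
  multiplicative λ-minimal relative and the shift certificate has Mazur's MC, hence (with its
  Schneider certificate) the residue is EXACT there: `O9.ExceptionalLeadingTermAt W p ↔ BSDp W p` —
  on such pairs the O9 residue is literally the `p`-part of BSD. (EVIDENCE to be supplied by the
  instrument seats: how many of the 191 non-λ-minimal split window cells have such a relative —
  `LEAD-DEAL-o9p.md` T-O9P-2 (c); the isogeny version adds 0 cells, `O9/LAMMIN-CLASS-typer6.md`.)

Nothing is booked by this file; no mark moves; O9's irreducible residue is unchanged.

References: [GreenbergVatsal2000] Thm. (1.4), §1 (5)–(7), pp. 14–15, §2 pp. 20–27;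
[Wuthrich2014] Thm. 16; [SteinWuthrich2013] Thm. 6.1, §4.2; [MazurTateTeitelbaum1986Invent] §II.10;
[Disegni2020] Conj. (BSD_p); [Miller2011LMS] Def. 1.1; [SilvermanATAEC1994] Thm. V.5.3, Cor. V.5.4;
HOME/class-closure/O9/{LEAD-DEAL-o9p.md, SUBPARTITION-typed.md, LAMMIN-CLASS-typer6.md}.
-/

set_option autoImplicit false

noncomputable section

open scoped Classical MatrixGroups ModularForm

open PowerSeries CongruenceSubgroup WeierstrassCurve NumberField IsDedekindDomain
  Literature.NumberTheory.EllipticCurves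
  Literature.NumberTheory.EllipticCurves.ModularForms
  Literature.NumberTheory.EllipticCurves.Rank1Residual
  Literature.NumberTheory.EllipticCurves.Rank1Residual.Typed
  Literature.NumberTheory.EllipticCurves.Wuthrich2014
  Literature.NumberTheory.EllipticCurves.SteinWuthrich2013
  Literature.NumberTheory.EllipticCurves.Greenberg1999
  Literature.NumberTheory.EllipticCurves.GreenbergVatsal2000
  Literature.NumberTheory.EllipticCurves.Disegni2020
  Summit.BirchSwinnertonDyer.BirchSwinnertonDyer.Theorems.Rank1ResidualX1Defs
  Summit.BirchSwinnertonDyer.Rank1Residual.X1.MuLambda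
  Summit.BirchSwinnertonDyer.Rank1Residual.X1.MuPart
  Summit.BirchSwinnertonDyer.Rank1Residual.X1.ParitySqueeze
  Summit.BirchSwinnertonDyer.Rank1Residual.X1.TamagawaSqueeze
  Summit.BirchSwinnertonDyer.Rank1Residual.X1.CongruenceTransfer
  Summit.BirchSwinnertonDyer.Rank1Residual.X2.CongruentLambdaShiftMultiplicative

namespace Summit.BirchSwinnertonDyer.Rank1Residual.X2

/-! ## §0. The parity type is a congruence invariant (negative bookkeeping for route G) -/

section Parity

variable {W W' : WeierstrassCurve ℚ} {p : ℕ} [Fact p.Prime]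

/-- **`GVPar` is an invariant of the `Γ_ℚ`-module `E[p]`**: if `E₀[p] ≅ E₀'[p]` equivariantly
(`TorsionIso`), then `GVPar W p ↔ GVPar W' p` — rational lines, their ramification at `p` and their
parity pass along the isomorphism (`gvPar_of_map_injOn`, injective everywhere). Consequence for
route G: a congruent relative never moves a pair across the GV / ¬GV sub-cell boundary; in
particular "relative of GV parity ⇒ MC at the relative by Greenberg–Vatsal" only ever serves targets
that are of GV parity themselves. [cite: GreenbergVatsal2000, Thm. (1.3) and Thm. (1.4) (hypothesis "E₁[p] ≅ E₂[p]")] -/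
theorem gvPar_iff_of_torsionIso (hiso : TorsionIso W W' p) : GVPar W p ↔ GVPar W' p := by
  constructor
  · rintro ⟨Φ, hΦ, hQ⟩
    obtain ⟨e, he⟩ := hiso
    exact gvPar_of_map_injOn e.toAddMonoidHom he hΦ (fun P _ hP ↦ e.injective (by simpa using hP)) hQ
  · rintro ⟨Φ, hΦ, hQ⟩
    obtain ⟨e, he⟩ := hiso.symm
    exact gvPar_of_map_injOn e.toAddMonoidHom he hΦ (fun P _ hP ↦ e.injective (by simpa using hP)) hQ

/-- The contrapositive reading used on O9's `¬GVPar` cells: a relative of a `¬GVPar` pair is `¬GVPar`.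
[cite: GreenbergVatsal2000, Thm. (1.4) (hypothesis "E₁[p] ≅ E₂[p]")] -/
theorem not_gvPar_of_torsionIso_of_not_gvPar (hiso : TorsionIso W W' p) (h : ¬ GVPar W p) :
    ¬ GVPar W' p := fun h' ↦ h ((gvPar_iff_of_torsionIso hiso).mpr h')

end Parity

/-! ## §1. T-O9P-2 (a): SPLIT rank-one target, congruent relative with known main conjecture -/

section SplitRankOne

variable {W W' : WeierstrassCurve ℚ} [W.IsElliptic] [W.IsGloballyMinimal]
  [W'.IsElliptic] [W'.IsGloballyMinimal] {p : ℕ} [Fact p.Prime]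
  (S₀ : Finset (HeightOneSpectrum (𝓞 ℚ)))

/-- **Mazur's main conjecture at a SPLIT X2 pair from a CLOSED MULTIPLICATIVE relative** (any rank of
the target): eisenstein-p2's `mazurMainConjectureAt_of_closedRelative_mult_of_facts` with the split
bits of BOTH curves discharged — the relative of a split Eisenstein pair is split
(`split_iff_split_of_torsionIso`), so the two trivial-zero terms of the derived shift cancel and the
shift is `k = k' + Σ_{v ∈ S₀}(δ' − δ)`, with `n ≤ k + 1` at the target. Per-pair inputs: the
target's `(μ_an, λ_an) = (0, n)`, the relative's MC + `(0, n')` with `k' + 1 = n'`, `E₀[p] ≅ E₀'[p]`,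
`S₀`. [cite: GreenbergVatsal2000, Thm. (1.4), §1 (5)–(7), pp. 14–15, §2 pp. 20–27]
[cite: Wuthrich2014, Thm. 16 (p. 397)] -/
theorem mazurMainConjectureAt_of_closedRelative_mult_split_of_facts
    (hWu : thm16_charIdeal_dvd_multiplicative_of_reducible)
    (hpar : nonempty_modularParametrizationData)
    (hT : Silverman1994_thmV53_corV54_tateUniformisation.{0})
    (hT' : Silverman1994_thmV53_tateUniformisation.{0})
    (hAm : lambda_nonPrimitive_eq_add_sum_delta_multiplicative)
    (hBm : datumSelmer_divisible_of_finite_torsionBy) (hF : datumStrictSelmer_lt_datumSelmer_of_split)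
    (hp2 : p ≠ 2) (hsplit : W.HasSplitMultiplicativeReductionAtPrime p)
    (hred : ¬ W.HasIrreducibleModPGaloisRep p) {n : ℕ} (hμ0 : AnalyticMuLE W p 0)
    (hlam : AnalyticLambdaEq W p n)
    (hmult' : W'.HasMultiplicativeReductionAtPrime p) (hMC' : X2.MazurMainConjectureAt W' p)
    {n' k' : ℕ} (hμ0' : AnalyticMuLE W' p 0) (hlam' : AnalyticLambdaEq W' p n') (hk' : k' + 1 = n')
    (hS₀ : ∀ v ∈ S₀, ((p : ℕ) : 𝓞 ℚ) ∉ v.asIdeal)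
    (hS : ∀ v : HeightOneSpectrum (𝓞 ℚ), v ∉ S₀ → ((p : ℕ) : 𝓞 ℚ) ∉ v.asIdeal →
      W.HasGoodReductionAt v)
    (hS' : ∀ v : HeightOneSpectrum (𝓞 ℚ), v ∉ S₀ → ((p : ℕ) : 𝓞 ℚ) ∉ v.asIdeal →
      W'.HasGoodReductionAt v)
    (hiso : TorsionIso W W' p) {k : ℕ}
    (hk : (k : ℤ) = k' + ∑ v ∈ S₀, ((delta W' p v : ℤ) - (delta W p v : ℤ))) (hn : n ≤ k + 1) :
    X2.MazurMainConjectureAt W p := by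
  have hmult : W.HasMultiplicativeReductionAtPrime p := hsplit.hasMultiplicativeReductionAtPrime
  have hsplit' : W'.HasSplitMultiplicativeReductionAtPrime p :=
    (CongruentPartnerAnomalous.split_iff_split_of_torsionIso hT hT' hp2 hmult hmult' hred hiso).mp hsplit
  refine mazurMainConjectureAt_of_closedRelative_mult_of_facts S₀ hWu hpar hT hT' hAm hBm hF hp2 hmult
    hred hμ0 hlam hmult' hMC' hμ0' hlam' (fun hns' ↦ absurd hsplit' hns') (fun _ ↦ hk') hS₀ hS hS'
    hiso (k := k) ?_ (fun hns ↦ absurd hsplit hns) (fun _ ↦ hn)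
  rw [if_pos hsplit', if_pos hsplit, hk]
  ring

/-- **T-O9P-2 (a) — SPLIT X2c pair (rank ONE), CLOSED multiplicative relative, shift DERIVED, typed
exceptional leading term + Schneider certificate ⇒ `BSD(E₀, p)`.** The split twin of
`bsdp_of_coveredRelative_rankOne_of_not_split`: Mazur's MC at `(E₀,p)` by the previous theorem, then
cc-typer-6's `bsdp_of_cellC_of_split_of_mazurMainConjectureAt_of_exceptionalLeadingTerm` (Stein–Wuthrich
Thm. 6.1 `hJs` with THE §4.2 height `hHs`, Gross–Zagier `hGZ`, GZK, modularity). ALL class-level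
inputs REGISTERED facts; per pair: certificates, the congruence, the relative's MC, the Schneider
certificate, and the TYPED RESIDUE `O9.ExceptionalLeadingTermAt W p` (nothing asserted about it).
CONDITIONAL; nothing booked. [cite: GreenbergVatsal2000, Thm. (1.4), §1 (5)–(7), pp. 14–15, §2 pp. 20–27]
[cite: Wuthrich2014, Thm. 16 (p. 397)] [cite: SteinWuthrich2013, Thm. 6.1 (p. 20) and §4.2]
[cite: MazurTateTeitelbaum1986Invent, §II.10] [cite: Miller2011LMS, Def. 1.1] -/
theorem O9.bsdp_of_closedRelative_rankOne_split_of_exceptionalLeadingTerm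
    (hWu : thm16_charIdeal_dvd_multiplicative_of_reducible)
    (hJs : thm61_splitMultiplicative) (hHs : exists_isSplitMultCanonical)
    (hGZ : GrossZagier1986_thm_I_7_3) (hGZK : rank_eq_analyticRank_of_analyticRank_le_one)
    (hpar : nonempty_modularParametrizationData)
    (hT : Silverman1994_thmV53_corV54_tateUniformisation.{0})
    (hT' : Silverman1994_thmV53_tateUniformisation.{0})
    (hAm : lambda_nonPrimitive_eq_add_sum_delta_multiplicative)
    (hBm : datumSelmer_divisible_of_finite_torsionBy) (hF : datumStrictSelmer_lt_datumSelmer_of_split)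
    (hp2 : p ≠ 2) (hsplit : W.HasSplitMultiplicativeReductionAtPrime p)
    (hred : ¬ W.HasIrreducibleModPGaloisRep p) (hr : W.analyticRank = 1) {n : ℕ}
    (hμ0 : AnalyticMuLE W p 0) (hlam : AnalyticLambdaEq W p n)
    (hmult' : W'.HasMultiplicativeReductionAtPrime p) (hMC' : X2.MazurMainConjectureAt W' p)
    {n' k' : ℕ} (hμ0' : AnalyticMuLE W' p 0) (hlam' : AnalyticLambdaEq W' p n') (hk' : k' + 1 = n')
    (hS₀ : ∀ v ∈ S₀, ((p : ℕ) : 𝓞 ℚ) ∉ v.asIdeal)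
    (hS : ∀ v : HeightOneSpectrum (𝓞 ℚ), v ∉ S₀ → ((p : ℕ) : 𝓞 ℚ) ∉ v.asIdeal →
      W.HasGoodReductionAt v)
    (hS' : ∀ v : HeightOneSpectrum (𝓞 ℚ), v ∉ S₀ → ((p : ℕ) : 𝓞 ℚ) ∉ v.asIdeal →
      W'.HasGoodReductionAt v)
    (hiso : TorsionIso W W' p) {k : ℕ}
    (hk : (k : ℤ) = k' + ∑ v ∈ S₀, ((delta W' p v : ℤ) - (delta W p v : ℤ))) (hn : n ≤ k + 1)
    (hExc : O9.ExceptionalLeadingTermAt W p)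
    (hSch : ∀ (Dq : TateParameterData W p) (Dh : PAdicHeightData W p),
      IsSplitMultCanonical Dh Dq → SchneiderConjecture Dh) :
    BSDp W p :=
  bsdp_of_cellC_of_split_of_mazurMainConjectureAt_of_exceptionalLeadingTerm W p hJs hHs hGZ hGZK hpar
    ⟨hr, hp2, hred, hsplit.hasMultiplicativeReductionAtPrime⟩ hsplit
    (mazurMainConjectureAt_of_closedRelative_mult_split_of_facts S₀ hWu hpar hT hT' hAm hBm hF hp2 hsplit
      hred hμ0 hlam hmult' hMC' hμ0' hlam' hk' hS₀ hS hS' hiso hk hn)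
    hExc hSch

/-- **Variant (i): the relative is λ-MINIMAL** — a split multiplicative Eisenstein relative `E₀'` of
analytic rank `r' ≤ 1` with `(μ_an, λ_an)(E₀') = (0, r' + 1)`: its main conjecture is a THEOREM
(`mazurMainConjectureAt_of_lamMin`, Wuthrich Thm. 16 + the λ-squeeze; reducibility of `E₀'[p]` from
the congruence), so the only per-pair inputs left are certificates, the congruence, the typed
residue and the Schneider certificate; shift `k = r' + Σ_{v ∈ S₀}(δ' − δ)`, `n ≤ k + 1`.
[cite: GreenbergVatsal2000, Thm. (1.4), §1 (5)–(7), pp. 14–15, §2 pp. 20–27, p. 4]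
[cite: Wuthrich2014, Thm. 16 (p. 397)] [cite: SteinWuthrich2013, Thm. 6.1 (p. 20) and §4.2] -/
theorem O9.bsdp_of_lamMinRelative_rankOne_split_of_exceptionalLeadingTerm
    (hWu : thm16_charIdeal_dvd_multiplicative_of_reducible)
    (hJs : thm61_splitMultiplicative) (hJn : thm61_nonsplitMultiplicative)
    (hHs : exists_isSplitMultCanonical) (hHn : exists_isMultCanonical)
    (hGZ : GrossZagier1986_thm_I_7_3) (hGZK : rank_eq_analyticRank_of_analyticRank_le_one)
    (hpar : nonempty_modularParametrizationData)
    (hT : Silverman1994_thmV53_corV54_tateUniformisation.{0})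
    (hT' : Silverman1994_thmV53_tateUniformisation.{0})
    (hAm : lambda_nonPrimitive_eq_add_sum_delta_multiplicative)
    (hBm : datumSelmer_divisible_of_finite_torsionBy) (hF : datumStrictSelmer_lt_datumSelmer_of_split)
    (hp2 : p ≠ 2) (hsplit : W.HasSplitMultiplicativeReductionAtPrime p)
    (hred : ¬ W.HasIrreducibleModPGaloisRep p) (hr : W.analyticRank = 1) {n : ℕ}
    (hμ0 : AnalyticMuLE W p 0) (hlam : AnalyticLambdaEq W p n)
    (hmult' : W'.HasMultiplicativeReductionAtPrime p) (hr' : W'.analyticRank ≤ 1)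
    (hμ0' : AnalyticMuLE W' p 0) (hlam' : AnalyticLambdaEq W' p (W'.analyticRank + 1))
    (hS₀ : ∀ v ∈ S₀, ((p : ℕ) : 𝓞 ℚ) ∉ v.asIdeal)
    (hS : ∀ v : HeightOneSpectrum (𝓞 ℚ), v ∉ S₀ → ((p : ℕ) : 𝓞 ℚ) ∉ v.asIdeal →
      W.HasGoodReductionAt v)
    (hS' : ∀ v : HeightOneSpectrum (𝓞 ℚ), v ∉ S₀ → ((p : ℕ) : 𝓞 ℚ) ∉ v.asIdeal →
      W'.HasGoodReductionAt v)
    (hiso : TorsionIso W W' p) {k : ℕ}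
    (hk : (k : ℤ) = W'.analyticRank + ∑ v ∈ S₀, ((delta W' p v : ℤ) - (delta W p v : ℤ)))
    (hn : n ≤ k + 1) (hExc : O9.ExceptionalLeadingTermAt W p)
    (hSch : ∀ (Dq : TateParameterData W p) (Dh : PAdicHeightData W p),
      IsSplitMultCanonical Dh Dq → SchneiderConjecture Dh) :
    BSDp W p := by
  have hmult : W.HasMultiplicativeReductionAtPrime p := hsplit.hasMultiplicativeReductionAtPrime
  have hred' : ¬ W'.HasIrreducibleModPGaloisRep p := not_hasIrreducibleModPGaloisRep_of_torsionIso hiso hred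
  have hsplit' : W'.HasSplitMultiplicativeReductionAtPrime p :=
    (CongruentPartnerAnomalous.split_iff_split_of_torsionIso hT hT' hp2 hmult hmult' hred hiso).mp hsplit
  have hMC' : X2.MazurMainConjectureAt W' p :=
    mazurMainConjectureAt_of_lamMin hWu hJs hJn hHs hHn hGZK W' p hp2 hmult' hred' hr' hμ0'
      (fun hns' ↦ absurd hsplit' hns') (fun _ ↦ hlam')
  exact O9.bsdp_of_closedRelative_rankOne_split_of_exceptionalLeadingTerm S₀ hWu hJs hHs hGZ hGZK hpar hT
    hT' hAm hBm hF hp2 hsplit hred hr hμ0 hlam hmult' hMC' hμ0' hlam' (k' := W'.analyticRank) rfl hS₀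
    hS hS' hiso hk hn hExc hSch

/-- **Variant (iii): the relative is GOOD ORDINARY** (necessarily ANOMALOUS — a good relative of a
split Eisenstein pair has `a_p ≡ 1`, i.e. is class-N1-shaped) with the X1 main conjecture
`MazurMainConjecture W' p` taken as a HYPOTHESIS (its discharge is class N1's problem; nothing is
typed for it here): invariants by eisenstein-p2's `algebraicInvariantsEq_of_closedRelative_goodOrd_of_facts`
(needs in addition Wuthrich's integrality `hW16` and GV §2 at good ordinary `hGV`, `hA7`, `hB`),
Mazur's MC at the target by the squeeze `mazurMainConjectureAt_of_algebraicInvariantsEq`, then the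
split rank-one consumer. Shift `k = n' + Σ_{v ∈ S₀}(δ' − δ) − 1`, `n ≤ k + 1`.
[cite: GreenbergVatsal2000, Thm. (1.4), §1 (5)–(7), pp. 14–15, §2 pp. 20–27]
[cite: Wuthrich2014, Thm. 16 (p. 397)] [cite: SteinWuthrich2013, Thm. 6.1 (p. 20) and §4.2] -/
theorem O9.bsdp_of_goodRelative_rankOne_split_of_exceptionalLeadingTerm
    (hWu : thm16_charIdeal_dvd_multiplicative_of_reducible)
    (hW16 : Wuthrich2014.charIdeal_dvd_padicLFunction)
    (hJs : thm61_splitMultiplicative) (hHs : exists_isSplitMultCanonical)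
    (hGZ : GrossZagier1986_thm_I_7_3) (hGZK : rank_eq_analyticRank_of_analyticRank_le_one)
    (hpar : nonempty_modularParametrizationData)
    (hT : Silverman1994_thmV53_corV54_tateUniformisation.{0})
    (hT' : Silverman1994_thmV53_tateUniformisation.{0})
    (hAm : lambda_nonPrimitive_eq_add_sum_delta_multiplicative)
    (hBm : datumSelmer_divisible_of_finite_torsionBy) (hF : datumStrictSelmer_lt_datumSelmer_of_split)
    (hGV : imKummer_ge_greenbergCondition_at_p) (hA7 : lambda_nonPrimitive_eq_add_sum_delta)
    (hB : divisible_nonPrimitiveSelmerInfty_of_mu_eq_zero)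
    (hp2 : p ≠ 2) (hsplit : W.HasSplitMultiplicativeReductionAtPrime p)
    (hred : ¬ W.HasIrreducibleModPGaloisRep p) (hr : W.analyticRank = 1) {n : ℕ}
    (hμ0 : AnalyticMuLE W p 0) (hlam : AnalyticLambdaEq W p n)
    (hgood' : W'.HasGoodReductionAtPrime p) (hord' : ¬ (p : ℤ) ∣ W'.frobeniusTrace p)
    (hMC' : MazurMainConjecture W' p) {n' : ℕ}
    (hμ0' : X1.MuPart.AnalyticMuLE W' p 0) (hlam' : X1.ParitySqueeze.AnalyticLambdaEq W' p n')
    (hS₀ : ∀ v ∈ S₀, ((p : ℕ) : 𝓞 ℚ) ∉ v.asIdeal)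
    (hS : ∀ v : HeightOneSpectrum (𝓞 ℚ), v ∉ S₀ → ((p : ℕ) : 𝓞 ℚ) ∉ v.asIdeal →
      W.HasGoodReductionAt v)
    (hS' : ∀ v : HeightOneSpectrum (𝓞 ℚ), v ∉ S₀ → ((p : ℕ) : 𝓞 ℚ) ∉ v.asIdeal →
      W'.HasGoodReductionAt v)
    (hiso : TorsionIso W W' p) {k : ℕ}
    (hk : (k : ℤ) = n' + ∑ v ∈ S₀, ((delta W' p v : ℤ) - (delta W p v : ℤ)) - 1) (hn : n ≤ k + 1)
    (hExc : O9.ExceptionalLeadingTermAt W p)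
    (hSch : ∀ (Dq : TateParameterData W p) (Dh : PAdicHeightData W p),
      IsSplitMultCanonical Dh Dq → SchneiderConjecture Dh) :
    BSDp W p := by
  have hmult : W.HasMultiplicativeReductionAtPrime p := hsplit.hasMultiplicativeReductionAtPrime
  have hred' : ¬ W'.HasIrreducibleModPGaloisRep p := not_hasIrreducibleModPGaloisRep_of_torsionIso hiso hred
  have hinv : AlgebraicInvariantsEq W p k :=
    algebraicInvariantsEq_of_closedRelative_goodOrd_of_facts S₀ hWu hW16 hpar hT hT' hAm hBm hF hGV hA7 hB
      hp2 hmult hred hμ0 hgood' hord' hred' hMC' hμ0' hlam' hS₀ hS hS' hiso (k := k)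
      (by rw [if_pos hsplit, hk]; ring)
  have hMC : X2.MazurMainConjectureAt W p :=
    mazurMainConjectureAt_of_algebraicInvariantsEq hWu W p hp2 hmult hred hμ0 hlam hinv
      (fun hns ↦ absurd hsplit hns) (fun _ ↦ hn)
  exact bsdp_of_cellC_of_split_of_mazurMainConjectureAt_of_exceptionalLeadingTerm W p hJs hHs hGZ hGZK
    hpar ⟨hr, hp2, hred, hmult⟩ hsplit hMC hExc hSch

end SplitRankOne

/-! ## §2. T-O9P-2 (b): "λ-minimal somewhere in the congruence class" ⇒ the residue is EXACT -/

section Exact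

variable {W W' : WeierstrassCurve ℚ} [W.IsElliptic] [W.IsGloballyMinimal]
  [W'.IsElliptic] [W'.IsGloballyMinimal] {p : ℕ} [Fact p.Prime]
  (S₀ : Finset (HeightOneSpectrum (𝓞 ℚ)))

/-- **COROLLARY (T-O9P-2 (b)): on a split X2c pair with a congruent λ-MINIMAL multiplicative
relative (and the shift certificate), the typed residue is EXACT** — Mazur's MC at the pair comes
from the relative (§1 variant (i)), so with the pair's Schneider certificate eisenstein-p2's
`exceptionalLeadingTermAt_iff_bsdp_of_mazurMainConjectureAt_of_schneider_split` gives
`O9.ExceptionalLeadingTermAt W p ↔ BSDp W p`: on such pairs the O9 residue is literally the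
`p`-part of BSD, exactly as on the λ-minimal pairs themselves. Nothing asserted about the residue;
nothing booked. [cite: GreenbergVatsal2000, Thm. (1.4), §1 (5)–(7), pp. 14–15, §2 pp. 20–27]
[cite: Wuthrich2014, Thm. 16 (p. 397)] [cite: SteinWuthrich2013, Thm. 6.1 (p. 20) and §4.2]
[cite: MazurTateTeitelbaum1986Invent, §II.10] -/
theorem O9.exceptionalLeadingTermAt_iff_bsdp_of_lamMinRelative_split
    (hWu : thm16_charIdeal_dvd_multiplicative_of_reducible)
    (hJs : thm61_splitMultiplicative) (hJn : thm61_nonsplitMultiplicative)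
    (hHs : exists_isSplitMultCanonical) (hHn : exists_isMultCanonical)
    (hGZ : GrossZagier1986_thm_I_7_3) (hGZK : rank_eq_analyticRank_of_analyticRank_le_one)
    (hpar : nonempty_modularParametrizationData)
    (hT : Silverman1994_thmV53_corV54_tateUniformisation.{0})
    (hT' : Silverman1994_thmV53_tateUniformisation.{0})
    (hAm : lambda_nonPrimitive_eq_add_sum_delta_multiplicative)
    (hBm : datumSelmer_divisible_of_finite_torsionBy) (hF : datumStrictSelmer_lt_datumSelmer_of_split)
    (hp2 : p ≠ 2) (hsplit : W.HasSplitMultiplicativeReductionAtPrime p)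
    (hred : ¬ W.HasIrreducibleModPGaloisRep p) (hr : W.analyticRank = 1) {n : ℕ}
    (hμ0 : AnalyticMuLE W p 0) (hlam : AnalyticLambdaEq W p n)
    (hmult' : W'.HasMultiplicativeReductionAtPrime p) (hr' : W'.analyticRank ≤ 1)
    (hμ0' : AnalyticMuLE W' p 0) (hlam' : AnalyticLambdaEq W' p (W'.analyticRank + 1))
    (hS₀ : ∀ v ∈ S₀, ((p : ℕ) : 𝓞 ℚ) ∉ v.asIdeal)
    (hS : ∀ v : HeightOneSpectrum (𝓞 ℚ), v ∉ S₀ → ((p : ℕ) : 𝓞 ℚ) ∉ v.asIdeal →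
      W.HasGoodReductionAt v)
    (hS' : ∀ v : HeightOneSpectrum (𝓞 ℚ), v ∉ S₀ → ((p : ℕ) : 𝓞 ℚ) ∉ v.asIdeal →
      W'.HasGoodReductionAt v)
    (hiso : TorsionIso W W' p) {k : ℕ}
    (hk : (k : ℤ) = W'.analyticRank + ∑ v ∈ S₀, ((delta W' p v : ℤ) - (delta W p v : ℤ)))
    (hn : n ≤ k + 1)
    (hSch : ∀ (Dq : TateParameterData W p) (Dh : PAdicHeightData W p),
      IsSplitMultCanonical Dh Dq → SchneiderConjecture Dh) :
    O9.ExceptionalLeadingTermAt W p ↔ BSDp W p := by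
  have hmult : W.HasMultiplicativeReductionAtPrime p := hsplit.hasMultiplicativeReductionAtPrime
  have hred' : ¬ W'.HasIrreducibleModPGaloisRep p := not_hasIrreducibleModPGaloisRep_of_torsionIso hiso hred
  have hsplit' : W'.HasSplitMultiplicativeReductionAtPrime p :=
    (CongruentPartnerAnomalous.split_iff_split_of_torsionIso hT hT' hp2 hmult hmult' hred hiso).mp hsplit
  have hMC' : X2.MazurMainConjectureAt W' p :=
    mazurMainConjectureAt_of_lamMin hWu hJs hJn hHs hHn hGZK W' p hp2 hmult' hred' hr' hμ0'
      (fun hns' ↦ absurd hsplit' hns') (fun _ ↦ hlam')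
  have hMC : X2.MazurMainConjectureAt W p :=
    mazurMainConjectureAt_of_closedRelative_mult_split_of_facts S₀ hWu hpar hT hT' hAm hBm hF hp2 hsplit
      hred hμ0 hlam hmult' hMC' hμ0' hlam' (k' := W'.analyticRank) rfl hS₀ hS hS' hiso hk hn
  exact exceptionalLeadingTermAt_iff_bsdp_of_mazurMainConjectureAt_of_schneider_split W p hJs hHs hGZ hGZK
    hpar ⟨hr, hp2, hred, hmult⟩ hsplit hMC hSch

end Exact

end Summit.BirchSwinnertonDyer.Rank1Residual.X2

end
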